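import Mathlib.FieldTheory.PrimitiveElement
import Mathlib.NumberTheory.NumberField.InfinitePlace.Embeddings
import Literature.AlgebraicGeometry.Motives.ZarhinHodgeGroupAutC
import HarnessLib

/-!
# A number field that is not Galois over `ℚ`: `Aut(ℂ)` does not act freely on its complex embeddings

COR-CM (cell `pub-hodgecm2`), seat b30 gen 14 (2026-08-21); count-neutral; theorems only, no definition, no named
fact, no `sorry`.  First step of the derivation of the FRAME hypotheses of `CorCM/DihedralSexticPairHodgeOfMarkman.lean`
from «`K` is not Galois over `ℚ`».

* `exists_embedding_apply_not_mem_fieldRange` — if `K/ℚ` is NOT Galois, then for every `t₀ : K → ℂ` there are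
  `t : K → ℂ` and `x ∈ K` with `t(x) ∉ t₀(K)` (a primitive element `x`; its minimal polynomial does not split in `K`,
  so fewer than `[K:ℚ]` of its complex roots lie in `t₀(K)`, while the `[K:ℚ]` embeddings take pairwise distinct
  values at `x`) [folklore: `K/ℚ` normal ⟺ all conjugate fields `t(K) ⊂ ℂ` coincide];
* `exists_ringEquiv_comp_eq_and_comp_ne` — hence some `σ ∈ Aut(ℂ)` fixes `t₀` (indeed `t₀(K)` pointwise) and moves
  `t`: with `y = t(x) ∉ K₀ = t₀(K)`, the minimal polynomial of `y` over `K₀` has a second complex root `y' ≠ y`,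
  `K₀(y) → ℂ` has the two `K₀`-embeddings `y ↦ y`, `y ↦ y'`, and `Aut(ℂ)` is transitive on the complex embeddings of
  the countable field `K₀(y)` (the tree's `Motives.ZarhinLie.exists_ringEquiv_complex_comp_eq`).  So the stabiliser
  of `t₀` in `Aut(ℂ)` acts non-trivially on `Hom(K, ℂ)`: the action of `Gal(K^{gal}/ℚ)` on `Hom(K, ℚ̄)` is not free.

## References
* [Lang2002] S. Lang, *Algebra*, 3rd ed., V §3 (normal extensions: Thm. 3.3, NOR 2) and VI §1.

Provenance: Literature home (family `hodge`, namespace `Literature.NumberTheory.ComplexMultiplication.NonGaloisField`) of the Summits-side `CorCM/NonGaloisStabilizer` (cell `pub-hodgecm2`, COR-CM; all its imports are `Literature/` and Mathlib), which `Literature/` may not import; theorems only, no named fact, no definition. Nothing here bears on `HC_CM`. Lane `lit-hodgefound` (Layer A3: CM types, their Kubota ranks and Galois combinatorics), seat p20.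
-/

noncomputable section

open Polynomial IntermediateField

namespace Literature.NumberTheory.ComplexMultiplication.NonGaloisField

variable {K : Type} [Field K] [NumberField K]

/-- A number field all of whose complex embeddings take a primitive element into one conjugate field `t₀(K)` — in
particular one whose embeddings all have the same image — is Galois over `ℚ`: contrapositively, **if `K/ℚ` is not
Galois then some `t(x)` lies outside `t₀(K)`**. [cite: Lang2002, V §3 Thm. 3.3] -/
theorem exists_embedding_apply_not_mem_fieldRange (hK : ¬ IsGalois ℚ K) (t₀ : K →+* ℂ) :
    ∃ (t : K →+* ℂ) (x : K), t x ∉ t₀.fieldRange := by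
  classical
  -- a primitive element and its minimal polynomial
  obtain ⟨x, hx⟩ := Field.exists_primitive_element ℚ K
  set p : ℚ[X] := minpoly ℚ x with hp_def
  have hxint : IsIntegral ℚ x := IsIntegral.of_finite ℚ x
  have hpdeg : p.natDegree = Module.finrank ℚ K := (Field.primitive_element_iff_minpoly_natDegree_eq ℚ x).1 hx
  -- `p` does not split in `K` (else `K` would be a splitting field, hence normal, hence Galois)
  have hnsplit : ¬ Splits (p.map (algebraMap ℚ K)) := by
    intro hsplit
    apply hK
    haveI : IsSplittingField ℚ K p := by
      refine ⟨hsplit, ?_⟩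
      rw [eq_top_iff, ← (show (ℚ⟮x⟯).toSubalgebra = ⊤ by rw [hx]; rfl),
        adjoin_simple_toSubalgebra_of_isAlgebraic hxint.isAlgebraic]
      refine Algebra.adjoin_mono (Set.singleton_subset_iff.2 ?_)
      rw [mem_rootSet]
      exact ⟨minpoly.ne_zero hxint, minpoly.aeval ℚ x⟩
    haveI : Normal ℚ K := Normal.of_isSplittingField p
    exact isGalois_iff.2 ⟨inferInstance, inferInstance⟩
  -- the embeddings take pairwise distinct values at `x`
  have hinj : Function.Injective fun t : K →+* ℂ => t x := by
    intro t t' h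
    have h' := (Field.primitive_element_iff_algHom_eq_of_eval' ℚ ℂ
      (fun y : K => IsAlgClosed.splits ((minpoly ℚ y).map (algebraMap ℚ ℂ))) x).1 hx
      (a₁ := t.toRatAlgHom) (a₂ := t'.toRatAlgHom) (by simpa using h)
    exact RingHom.ext fun a => by simpa using AlgHom.congr_fun h' a
  -- if every `t x` lay in `t₀(K)`, the roots of `p` in `K` would be at least `[K:ℚ]` many
  by_contra hall
  push Not at hall
  have hroot : ∀ t : K →+* ℂ, ∃ z : K, t₀ z = t x ∧ z ∈ (p.map (algebraMap ℚ K)).roots := by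
    intro t
    obtain ⟨z, hz⟩ := (RingHom.mem_fieldRange).1 (hall t x)
    refine ⟨z, hz, ?_⟩
    rw [mem_roots (map_ne_zero (minpoly.ne_zero hxint)), IsRoot, eval_map, ← aeval_def]
    have e1 : t₀ (aeval z p) = aeval (t₀ z) p := by
      rw [show t₀ (aeval z p) = t₀.toRatAlgHom (aeval z p) from rfl, ← Polynomial.aeval_algHom_apply]; rfl
    have e2 : t (aeval x p) = aeval (t x) p := by
      rw [show t (aeval x p) = t.toRatAlgHom (aeval x p) from rfl, ← Polynomial.aeval_algHom_apply]; rfl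
    apply t₀.injective
    rw [map_zero, e1, hz, ← e2, hp_def, minpoly.aeval, map_zero]
  choose z hz using hroot
  have hzinj : Function.Injective z := by
    intro t t' h
    apply hinj
    change t x = t' x
    rw [← (hz t).1, ← (hz t').1, h]
  have hcard : Fintype.card (K →+* ℂ) ≤ (p.map (algebraMap ℚ K)).roots.toFinset.card := by
    rw [← Finset.card_univ, ← Finset.card_image_of_injective Finset.univ hzinj]
    exact Finset.card_le_card fun w hw => by
      obtain ⟨t, -, rfl⟩ := Finset.mem_image.1 hw
      exact Multiset.mem_toFinset.2 (hz t).2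
  have hlt : (p.map (algebraMap ℚ K)).roots.card < p.natDegree := by
    have hle := card_roots' (p.map (algebraMap ℚ K))
    rw [natDegree_map] at hle
    refine lt_of_le_of_ne hle fun h => hnsplit ?_
    rw [splits_iff_card_roots, natDegree_map]
    exact h
  have h1 := Multiset.toFinset_card_le (p.map (algebraMap ℚ K)).roots
  rw [NumberField.Embeddings.card, ← hpdeg] at hcard
  omega

/-- **If `K/ℚ` is not Galois, `Aut(ℂ)` does not act freely on `Hom(K, ℂ)`**: some automorphism of `ℂ` fixes the
embedding `t₀` and moves another embedding `t`. [cite: Lang2002, V §3 Thm. 3.3 and VI §1] -/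
theorem exists_ringEquiv_comp_eq_and_comp_ne (hK : ¬ IsGalois ℚ K) (t₀ : K →+* ℂ) :
    ∃ (σ : ℂ ≃+* ℂ) (t : K →+* ℂ), (σ : ℂ →+* ℂ).comp t₀ = t₀ ∧ (σ : ℂ →+* ℂ).comp t ≠ t := by
  classical
  obtain ⟨t, x, hx⟩ := exists_embedding_apply_not_mem_fieldRange hK t₀
  -- the conjugate field `K₀ = t₀(K) ⊂ ℂ` and `y = t x ∉ K₀`
  set K₀ : IntermediateField ℚ ℂ := t₀.toRatAlgHom.fieldRange with hK₀_def
  set y : ℂ := t x with hy_def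
  have hyK₀ : y ∉ K₀ := fun h => hx (by
    obtain ⟨a, ha⟩ := AlgHom.mem_fieldRange.1 h
    exact RingHom.mem_fieldRange.2 ⟨a, ha⟩)
  have hyint : IsIntegral K₀ y :=
    ((IsIntegral.of_finite ℚ x).map t.toRatAlgHom).tower_top
  -- the minimal polynomial of `y` over `K₀` has a second complex root `y'`
  set q := minpoly K₀ y with hq_def
  have hq2 : 2 ≤ q.natDegree := by
    rw [hq_def, minpoly.two_le_natDegree_iff hyint]
    rintro ⟨z, hz⟩
    exact hyK₀ (by rw [← hz]; exact z.2)
  have hqsep : q.Separable := (minpoly.irreducible hyint).separable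
  have hcard : Fintype.card (q.rootSet ℂ) = q.natDegree :=
    card_rootSet_eq_natDegree hqsep (IsAlgClosed.splits _)
  have hy_root : y ∈ q.rootSet ℂ := by
    rw [mem_rootSet]
    exact ⟨minpoly.ne_zero hyint, minpoly.aeval K₀ y⟩
  obtain ⟨⟨y', hy'⟩, hne⟩ := Fintype.exists_ne_of_one_lt_card (by rw [hcard]; omega) (⟨y, hy_root⟩ : q.rootSet ℂ)
  have hne' : y' ≠ y := fun h => hne (Subtype.ext h)
  have hy'a : y' ∈ q.aroots ℂ := by
    rw [mem_rootSet'] at hy'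
    exact mem_aroots'.2 ⟨hy'.1, hy'.2⟩
  -- two `K₀`-embeddings of `K₀(y)`: the inclusion and `y ↦ y'`
  set u₁ : K₀⟮y⟯ →ₐ[K₀] ℂ := (K₀⟮y⟯).val with hu₁
  set u₂ : K₀⟮y⟯ →ₐ[K₀] ℂ := (algHomAdjoinIntegralEquiv K₀ hyint).symm ⟨y', hy'a⟩ with hu₂
  have hu₂gen : u₂ (AdjoinSimple.gen K₀ y) = y' := algHomAdjoinIntegralEquiv_symm_apply_gen K₀ hyint ⟨y', hy'a⟩
  -- `K₀(y)` is countable, so `Aut(ℂ)` carries `u₁` to `u₂`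
  haveI : Countable K := Countable.of_equiv _ (Module.finBasis ℚ K).equivFun.toEquiv.symm
  haveI : Countable K₀ := by
    have hc : (Set.range t₀).Countable := Set.countable_range _
    have : (K₀ : Set ℂ) = Set.range t₀ := by
      rw [hK₀_def, AlgHom.coe_fieldRange]; rfl
    rw [← this] at hc
    exact hc.to_subtype
  haveI : FiniteDimensional K₀ K₀⟮y⟯ := adjoin.finiteDimensional hyint
  haveI : Countable K₀⟮y⟯ :=
    Countable.of_equiv _ (Module.finBasis K₀ K₀⟮y⟯).equivFun.toEquiv.symm
  obtain ⟨σ, hσ⟩ := Literature.AlgebraicGeometry.Motives.ZarhinLie.exists_ringEquiv_complex_comp_eq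
    u₁.toRingHom u₂.toRingHom
  refine ⟨σ, t, RingHom.ext fun a => ?_, fun h => hne' ?_⟩
  · -- `σ` fixes `t₀(K)` pointwise
    have ha : t₀ a ∈ K₀ := AlgHom.mem_fieldRange.2 ⟨a, rfl⟩
    have h1 := hσ (algebraMap K₀ K₀⟮y⟯ ⟨t₀ a, ha⟩)
    rw [AlgHom.toRingHom_eq_coe, AlgHom.toRingHom_eq_coe, AlgHom.coe_toRingHom, AlgHom.coe_toRingHom,
      AlgHom.commutes, AlgHom.commutes] at h1
    exact h1
  · -- `σ y = y'`
    have h1 := hσ (AdjoinSimple.gen K₀ y)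
    rw [AlgHom.toRingHom_eq_coe, AlgHom.toRingHom_eq_coe, AlgHom.coe_toRingHom, AlgHom.coe_toRingHom, hu₂gen,
      hu₁] at h1
    change σ ((AdjoinSimple.gen K₀ y : K₀⟮y⟯) : ℂ) = y' at h1
    rw [AdjoinSimple.coe_gen] at h1
    have h2 : σ (t x) = t x := by
      have := RingHom.congr_fun h x
      simpa using this
    rw [← h1]
    exact h2

end Literature.NumberTheory.ComplexMultiplication.NonGaloisField

end
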